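import Mathlib
import HarnessLib
import Summits.HubbardSuperconductivity.HubbardSuperconductivity.Theorems.KLProgrammeKLRegimeEngineTowerModelReadout

/-!
# Route `KLProgramme` — crux K3 ENGINE (stmt-HubbardSuperconductivity-20437 `KLRegimeEngineV17F2`), stub (b) v2, THE LEVELS PACKAGE (ℓ):
# the MODEL TOWER DATA — block increments of the scale flow at a fixed frame and their born / measured sizes in the two currencies
# (E1-LEVELS-BLUEPRINT-g8 §1–§2 / §6 step 1; E1 lead r2d-p2 g8)

The one-shot blocked tower at the frame `K` (blueprint §1): block length `d`, boundaries `J_k = d·k`, block increments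
`Δ_k := 𝒱_{d(k+1)}[K] − 𝒱_{dk}[K]` (`𝒱_j[K] = klEffectiveAction L M β U μ K klE0 j`; `klEffectiveAction_eq_blocked`, part 13).  CONVENTION (blueprint §1,
from …EngineNormsStepDoor / …SectorRadialAlignment: the thin family `F_J := klAnisoFamily … J` is a partition of unity exactly on `{t ≤ Λ_{J+1}}` and the block
covariance `C^K_{(Λ_{d(k+1)}, Λ_{dk}]}` lives on `{t ≤ Λ_{dk}}`): the block step `k ≥ 1` runs with INPUT family `F_{dk−1}` (+ fat partner) and OUTPUT family `F_{dk}` —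
**the born sizes of `Δ_k` are measured at the COARSE END `F_{dk}`**; as an input of block `k+1` an increment is RE-measured at `F_{d(k+1)−1}` (jump `≥ d−1`).

This file introduces the carriers only (definitions with bodies + `rfl`/order rows):
* §1 `klTowerIncr L M β U μ K d k` := `Δ_k`; `klTowerInput L M β U μ K d k` := `𝒱_{dk}[K]` (the input of block `k`);
* §2 the two currencies for an ARBITRARY Grassmann element `T` at family `F_J` (part 13 spelled them out without naming them):
  `klWtPinnedSumOf L M β μ K J m T q w` (weighted pinned sum; `= klWtPinnedSum …` at `T = 𝒱_J`, `klWtPinnedSumOf_klEffectiveAction`) and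
  `klLevNormOf L M β μ K J m T Ωe` (levelled sectorised norm; `= klAnisoLegKernelNormAt …` at `T = 𝒱_J`, `klLevNormOf_klEffectiveAction`);
* §4 the UV datum `klTowerUVWt/klTowerUVLev` := the PLAIN (trivial one-sector family) sizes of `𝒱_0[K]` (block `0`'s input and the kit's `b 0` in virtual units);
* §3 the tower's size arrays as SUPREMA over the finite pin / prescription data: `klTowerBornWt … d k m` (born, weighted, at `F_{dk}`), `klTowerBornLev … d k m F`
  (born, levelled at level-count `F`, at `F_{dk}`), `klTowerMeasWt … d k m` / `klTowerMeasLev … d k m F` (the INPUT `𝒱_{dk}` of block `k` measured at `F_{dk−1}`, the kit's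
  Chernoff data `μ k ·`; block `0`'s input `𝒱_0` is read in the trivial one-sector family — blueprint §1); the pointwise `≤` rows (`klWtPinnedSumOf_le_klTowerBornWt`, …) and nonnegativity.
The DIMENSIONLESS arrays of the kit (`b k p := klTowerBornWt … k (2p) / 2^{(3p−5)dk}` etc., blueprint §2) are formed at the point of use; the units are pure scale units.
Definitions with bodies + `rfl`/order rows; nothing about the model is asserted; nothing asserts superconductivity.
References: BGM 2006 §2.8, Lemma 2.5 (2.98), §3 (3.2)–(3.8) [cite: BenfattoGiulianiMastropietro2006].
-/

noncomputable section

namespace Summit.HubbardSuperconductivity.HubbardSuperconductivity.Theorems.EngineV8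

set_option linter.dupNamespace false -- summit = problem name (single-conjunct summit), D-0017

open Real Finset Literature.MathematicalPhysics.QuantumLattice Literature.Probability.LatticeModels
open Literature.MathematicalPhysics.QuantumLattice.FermiRG
open Summit.HubbardSuperconductivity.HubbardSuperconductivity.Theorems.KLRegimeSplit
open Summit.HubbardSuperconductivity.HubbardSuperconductivity.Theorems.KLProgrammeLegKernels
open Summit.HubbardSuperconductivity.HubbardSuperconductivity.Theorems.DispersionFlow

variable (L M : ℕ) [NeZero L]

/-! ## §1 Block increments and block inputs -/

/-- **`klTowerIncr L M β U μ K d k`** — the block increment `Δ_k := 𝒱_{d(k+1)}[K] − 𝒱_{dk}[K]` of the scale flow at the frame `K` (block length `d`). -/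
def klTowerIncr (β U μ : ℝ) (K : TrigPolyC4v) (d k : ℕ) : HubbardGrassmann L M :=
  klEffectiveAction L M β U μ K klE0 (d * (k + 1)) - klEffectiveAction L M β U μ K klE0 (d * k)

/-- **`klTowerInput L M β U μ K d k`** — the input of block `k`: the scale-`dk` action `𝒱_{dk}[K]`. -/
def klTowerInput (β U μ : ℝ) (K : TrigPolyC4v) (d k : ℕ) : HubbardGrassmann L M :=
  klEffectiveAction L M β U μ K klE0 (d * k)

variable {L M}

/-- `𝒱_{d(k+1)} = 𝒱_{dk} + Δ_k`. -/
theorem klTowerInput_succ (β U μ : ℝ) (K : TrigPolyC4v) (d k : ℕ) :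
    klTowerInput L M β U μ K d (k + 1) = klTowerInput L M β U μ K d k + klTowerIncr L M β U μ K d k := by
  unfold klTowerInput klTowerIncr; abel

/-- `𝒱_{dk} = 𝒱_0 + Σ_{k′ < k} Δ_{k′}` (part 13's blocked decomposition at a boundary). -/
theorem klTowerInput_eq_zero_add_sum (β U μ : ℝ) (K : TrigPolyC4v) (d k : ℕ) :
    klTowerInput L M β U μ K d k = klEffectiveAction L M β U μ K klE0 0 + ∑ k' ∈ range k, klTowerIncr L M β U μ K d k' := by
  induction k with
  | zero => simp [klTowerInput]
  | succ k ih => rw [klTowerInput_succ, ih, sum_range_succ, add_assoc]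

variable (L M)

/-! ## §2 The two level currencies of an arbitrary Grassmann element at the thin family `F_J` -/

/-- **`klWtPinnedSumOf L M β μ K J m T q w`** — the WEIGHTED pinned sum at family `F_J = klAnisoFamily … K klE0 J` of the degree-`m` kernel of the analysed
element `map (toLin' E(F_J)) T`, leg `q` pinned at `w`: `ε_x^{m−1} · Σ_{X : X q = w} klScaleWt_J(pos X) · ‖kernel (map E_J T) m X‖` (part 13's spelled-out form). -/
def klWtPinnedSumOf (β μ : ℝ) (K : TrigPolyC4v) (J m : ℕ) (T : HubbardGrassmann L M) (q : Fin m)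
    (w : SpaceTimeIdx L M × SectorLeg (sectorCount J)) : ℝ :=
  imagTimeWeight β M ^ (m - 1) *
    ∑ X ∈ univ.filter (fun X : Fin m → SpaceTimeIdx L M × SectorLeg (sectorCount J) => X q = w),
      klScaleWt L M β J ((univ.image X).image (latticeLegPos (2 * (2 * M)))) *
        ‖kernel ℂ (ExteriorAlgebra.map (Matrix.toLin' (sectorAnalysisMatrix L M β (klAnisoFamily L M β μ K klE0 J))) T) m X‖

/-- **`klLevNormOf L M β μ K J m T Ωe`** — the LEVELLED sectorised `L¹–L^∞` norm at family `F_J` of the degree-`m` kernel of `T` at the prescription `Ωe`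
(`hubbardSectorKernelNorm … (prescribedTuples (bgmSectorSet …) Ωe) T`). -/
def klLevNormOf (β μ : ℝ) (K : TrigPolyC4v) (J m : ℕ) (T : HubbardGrassmann L M) (Ωe : Fin m → Option (SectorLeg (sectorCount J))) : ℝ :=
  hubbardSectorKernelNorm L M β (klAnisoFamily L M β μ K klE0 J)
    (prescribedTuples (bgmSectorSet L M (klAnisoFamily L M β μ K klE0 J) m) Ωe) T

variable {L M}

/-- At `T = 𝒱_J[K]` the weighted pinned sum IS `klWtPinnedSum` (`rfl`). -/
theorem klWtPinnedSumOf_klEffectiveAction (β U μ : ℝ) (K : TrigPolyC4v) (J m : ℕ) (q : Fin m)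
    (w : SpaceTimeIdx L M × SectorLeg (sectorCount J)) :
    klWtPinnedSumOf L M β μ K J m (klEffectiveAction L M β U μ K klE0 J) q w = klWtPinnedSum L M β U μ K J m q w := rfl

/-- At `T = 𝒱_J[K]` the levelled norm IS `klAnisoLegKernelNormAt … klE0 J` (`rfl`). -/
theorem klLevNormOf_klEffectiveAction (β U μ : ℝ) (K : TrigPolyC4v) (J m : ℕ) (Ωe : Fin m → Option (SectorLeg (sectorCount J))) :
    klLevNormOf L M β μ K J m (klEffectiveAction L M β U μ K klE0 J) Ωe = klAnisoLegKernelNormAt L M β U μ K klE0 J m Ωe := rfl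

/-- The weighted pinned sum is nonnegative (`0 ≤ β`). -/
theorem klWtPinnedSumOf_nonneg {β : ℝ} (hβ : 0 ≤ β) (μ : ℝ) (K : TrigPolyC4v) (J m : ℕ) (T : HubbardGrassmann L M) (q : Fin m)
    (w : SpaceTimeIdx L M × SectorLeg (sectorCount J)) : 0 ≤ klWtPinnedSumOf L M β μ K J m T q w :=
  mul_nonneg (pow_nonneg (imagTimeWeight_nonneg hβ M) _)
    (sum_nonneg fun _ _ => mul_nonneg (zero_le_one.trans (one_le_klScaleWt L M β J _)) (norm_nonneg _))

/-- The weighted pinned sum of a finite sum is at most the sum (part 13 `wtPinnedSum_sum_le`, by name). -/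
theorem klWtPinnedSumOf_sum_le {β : ℝ} (hβ : 0 ≤ β) (μ : ℝ) (K : TrigPolyC4v) (J m : ℕ) {ι : Type*} (s : Finset ι)
    (T : ι → HubbardGrassmann L M) (q : Fin m) (w : SpaceTimeIdx L M × SectorLeg (sectorCount J)) :
    klWtPinnedSumOf L M β μ K J m (∑ i ∈ s, T i) q w ≤ ∑ i ∈ s, klWtPinnedSumOf L M β μ K J m (T i) q w :=
  wtPinnedSum_sum_le hβ μ K J m s T q w

/-- The levelled norm of a finite sum is at most the sum (part 13 `hubbardSectorKernelNorm_sum_le`). -/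
theorem klLevNormOf_sum_le {β : ℝ} (hβ : 0 ≤ β) (μ : ℝ) (K : TrigPolyC4v) (J m : ℕ) {ι : Type*} (s : Finset ι)
    (T : ι → HubbardGrassmann L M) (Ωe : Fin m → Option (SectorLeg (sectorCount J))) :
    klLevNormOf L M β μ K J m (∑ i ∈ s, T i) Ωe ≤ ∑ i ∈ s, klLevNormOf L M β μ K J m (T i) Ωe :=
  hubbardSectorKernelNorm_sum_le hβ _ _ s T

variable (L M)

/-! ## §3 The tower's size arrays (suprema over the finite pin / prescription data) -/

/-- **`klTowerBornWt L M β U μ K d k m`** — the BORN weighted size of block `k` in degree `m`: the supremum over pins `(q, w)` of the weighted pinned sums of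
`Δ_k` at its born family `F_{dk}` (coarse end of the block). -/
def klTowerBornWt (β U μ : ℝ) (K : TrigPolyC4v) (d k m : ℕ) : ℝ :=
  ⨆ qw : Fin m × (SpaceTimeIdx L M × SectorLeg (sectorCount (d * k))),
    klWtPinnedSumOf L M β μ K (d * k) m (klTowerIncr L M β U μ K d k) qw.1 qw.2

/-- **`klTowerBornLev L M β U μ K d k m F`** — the BORN levelled size of block `k` in degree `m` at level-count `F`: the supremum over prescriptions `Ωe` with
`levelCount Ωe = F` of the levelled norms of `Δ_k` at `F_{dk}` (`0` if there is none). -/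
def klTowerBornLev (β U μ : ℝ) (K : TrigPolyC4v) (d k m F : ℕ) : ℝ :=
  ⨆ Ωe : {Ωe : Fin m → Option (SectorLeg (sectorCount (d * k))) // levelCount Ωe = F},
    klLevNormOf L M β μ K (d * k) m (klTowerIncr L M β U μ K d k) Ωe.1

/-- **`klTowerMeasWt L M β U μ K d k m`** — the MEASURED weighted size of the input of block `k`: the supremum over pins of the weighted pinned sums of
`𝒱_{dk}` at the block's input family `F_{dk−1}` (the kit's Chernoff datum `μ k ·`, up to units; meaningful for `k ≥ 1` — block `0`'s input `𝒱_0` has no thin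
input family and is read in the trivial one-sector family, blueprint §1). -/
def klTowerMeasWt (β U μ : ℝ) (K : TrigPolyC4v) (d k m : ℕ) : ℝ :=
  ⨆ qw : Fin m × (SpaceTimeIdx L M × SectorLeg (sectorCount (d * k - 1))),
    klWtPinnedSumOf L M β μ K (d * k - 1) m (klTowerInput L M β U μ K d k) qw.1 qw.2

/-- **`klTowerMeasLev L M β U μ K d k m F`** — the MEASURED levelled size of the input `𝒱_{dk}` of block `k` at level-count `F`, family `F_{dk−1}` (`k ≥ 1`). -/
def klTowerMeasLev (β U μ : ℝ) (K : TrigPolyC4v) (d k m F : ℕ) : ℝ :=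
  ⨆ Ωe : {Ωe : Fin m → Option (SectorLeg (sectorCount (d * k - 1))) // levelCount Ωe = F},
    klLevNormOf L M β μ K (d * k - 1) m (klTowerInput L M β U μ K d k) Ωe.1

variable {L M}

/-- Every weighted pinned sum of `Δ_k` at `F_{dk}` is at most the born weighted size. -/
theorem klWtPinnedSumOf_le_klTowerBornWt (β U μ : ℝ) (K : TrigPolyC4v) (d k m : ℕ) (q : Fin m)
    (w : SpaceTimeIdx L M × SectorLeg (sectorCount (d * k))) :
    klWtPinnedSumOf L M β μ K (d * k) m (klTowerIncr L M β U μ K d k) q w ≤ klTowerBornWt L M β U μ K d k m :=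
  le_ciSup (f := fun qw : Fin m × (SpaceTimeIdx L M × SectorLeg (sectorCount (d * k))) =>
    klWtPinnedSumOf L M β μ K (d * k) m (klTowerIncr L M β U μ K d k) qw.1 qw.2) (Set.finite_range _).bddAbove (q, w)

/-- Every levelled norm of `Δ_k` at `F_{dk}` is at most the born levelled size at its level-count. -/
theorem klLevNormOf_le_klTowerBornLev (β U μ : ℝ) (K : TrigPolyC4v) (d k m : ℕ) (Ωe : Fin m → Option (SectorLeg (sectorCount (d * k)))) :
    klLevNormOf L M β μ K (d * k) m (klTowerIncr L M β U μ K d k) Ωe ≤ klTowerBornLev L M β U μ K d k m (levelCount Ωe) :=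
  le_ciSup (f := fun Ωe' : {Ωe' : Fin m → Option (SectorLeg (sectorCount (d * k))) // levelCount Ωe' = levelCount Ωe} =>
    klLevNormOf L M β μ K (d * k) m (klTowerIncr L M β U μ K d k) Ωe'.1) (Set.finite_range _).bddAbove ⟨Ωe, rfl⟩

/-- Every weighted pinned sum of the input `𝒱_{dk}` at `F_{dk−1}` is at most the measured weighted size. -/
theorem klWtPinnedSumOf_le_klTowerMeasWt (β U μ : ℝ) (K : TrigPolyC4v) (d k m : ℕ) (q : Fin m)
    (w : SpaceTimeIdx L M × SectorLeg (sectorCount (d * k - 1))) :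
    klWtPinnedSumOf L M β μ K (d * k - 1) m (klTowerInput L M β U μ K d k) q w ≤ klTowerMeasWt L M β U μ K d k m :=
  le_ciSup (f := fun qw : Fin m × (SpaceTimeIdx L M × SectorLeg (sectorCount (d * k - 1))) =>
    klWtPinnedSumOf L M β μ K (d * k - 1) m (klTowerInput L M β U μ K d k) qw.1 qw.2) (Set.finite_range _).bddAbove (q, w)

/-- Every levelled norm of the input `𝒱_{dk}` at `F_{dk−1}` is at most the measured levelled size at its level-count. -/
theorem klLevNormOf_le_klTowerMeasLev (β U μ : ℝ) (K : TrigPolyC4v) (d k m : ℕ)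
    (Ωe : Fin m → Option (SectorLeg (sectorCount (d * k - 1)))) :
    klLevNormOf L M β μ K (d * k - 1) m (klTowerInput L M β U μ K d k) Ωe ≤ klTowerMeasLev L M β U μ K d k m (levelCount Ωe) :=
  le_ciSup (f := fun Ωe' : {Ωe' : Fin m → Option (SectorLeg (sectorCount (d * k - 1))) // levelCount Ωe' = levelCount Ωe} =>
    klLevNormOf L M β μ K (d * k - 1) m (klTowerInput L M β U μ K d k) Ωe'.1) (Set.finite_range _).bddAbove ⟨Ωe, rfl⟩

/-- The born weighted size is nonnegative (`0 ≤ β`; for `m = 0` the index type is empty and the supremum is `0`). -/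
theorem klTowerBornWt_nonneg {β : ℝ} (hβ : 0 ≤ β) (U μ : ℝ) (K : TrigPolyC4v) (d k m : ℕ) : 0 ≤ klTowerBornWt L M β U μ K d k m := by
  unfold klTowerBornWt
  rcases isEmpty_or_nonempty (Fin m × (SpaceTimeIdx L M × SectorLeg (sectorCount (d * k)))) with h | h
  · rw [Real.iSup_of_isEmpty]
  · exact le_ciSup_of_le (Set.finite_range _).bddAbove (Classical.arbitrary _) (klWtPinnedSumOf_nonneg hβ μ K _ m _ _ _)

/-- The measured weighted size is nonnegative (`0 ≤ β`). -/
theorem klTowerMeasWt_nonneg {β : ℝ} (hβ : 0 ≤ β) (U μ : ℝ) (K : TrigPolyC4v) (d k m : ℕ) : 0 ≤ klTowerMeasWt L M β U μ K d k m := by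
  unfold klTowerMeasWt
  rcases isEmpty_or_nonempty (Fin m × (SpaceTimeIdx L M × SectorLeg (sectorCount (d * k - 1)))) with h | h
  · rw [Real.iSup_of_isEmpty]
  · exact le_ciSup_of_le (Set.finite_range _).bddAbove (Classical.arbitrary _) (klWtPinnedSumOf_nonneg hβ μ K _ m _ _ _)

variable (L M)

/-! ## §4 The UV datum: PLAIN sizes of the scale-`0` action (block `0` runs in the trivial one-sector family, blueprint §1 `k = 0`) -/

/-- **`klTowerUVWt L M β U μ K m`** — the UV datum, weighted track: the supremum over pins of the weighted pinned sums of `𝒱_0[K]` analysed in the TRIVIAL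
one-sector family `trivialMultiplier` (= the position-space kernels; scale-`0` weight `klScaleWt … 0`).  The kit reads it in virtual units (blueprint §1). -/
def klTowerUVWt (β U μ : ℝ) (K : TrigPolyC4v) (m : ℕ) : ℝ :=
  ⨆ qw : Fin m × (SpaceTimeIdx L M × SectorLeg 1),
    imagTimeWeight β M ^ (m - 1) *
      ∑ X ∈ univ.filter (fun X : Fin m → SpaceTimeIdx L M × SectorLeg 1 => X qw.1 = qw.2),
        klScaleWt L M β 0 ((univ.image X).image (latticeLegPos (2 * (2 * M)))) *
          ‖kernel ℂ (ExteriorAlgebra.map (Matrix.toLin' (sectorAnalysisMatrix L M β (trivialMultiplier L M)))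
              (klEffectiveAction L M β U μ K klE0 0)) m X‖

/-- **`klTowerUVLev L M β U μ K m`** — the UV datum, plain track: the trivial-family sectorised `L¹–L^∞` norm of the degree-`m` kernel of `𝒱_0[K]`, all tuples
(no prescription: the one-sector family has no levels). -/
def klTowerUVLev (β U μ : ℝ) (K : TrigPolyC4v) (m : ℕ) : ℝ :=
  hubbardSectorKernelNorm L M β (trivialMultiplier L M) (univ : Finset (Fin m → SectorLeg 1)) (klEffectiveAction L M β U μ K klE0 0)

variable {L M}

/-- Every trivial-family weighted pinned sum of `𝒱_0` is at most the UV datum. -/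
theorem uvWtPinnedSum_le_klTowerUVWt (β U μ : ℝ) (K : TrigPolyC4v) (m : ℕ) (q : Fin m) (w : SpaceTimeIdx L M × SectorLeg 1) :
    imagTimeWeight β M ^ (m - 1) *
        ∑ X ∈ univ.filter (fun X : Fin m → SpaceTimeIdx L M × SectorLeg 1 => X q = w),
          klScaleWt L M β 0 ((univ.image X).image (latticeLegPos (2 * (2 * M)))) *
            ‖kernel ℂ (ExteriorAlgebra.map (Matrix.toLin' (sectorAnalysisMatrix L M β (trivialMultiplier L M)))
                (klEffectiveAction L M β U μ K klE0 0)) m X‖ ≤ klTowerUVWt L M β U μ K m :=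
  le_ciSup (f := fun qw : Fin m × (SpaceTimeIdx L M × SectorLeg 1) =>
    imagTimeWeight β M ^ (m - 1) *
      ∑ X ∈ univ.filter (fun X : Fin m → SpaceTimeIdx L M × SectorLeg 1 => X qw.1 = qw.2),
        klScaleWt L M β 0 ((univ.image X).image (latticeLegPos (2 * (2 * M)))) *
          ‖kernel ℂ (ExteriorAlgebra.map (Matrix.toLin' (sectorAnalysisMatrix L M β (trivialMultiplier L M)))
              (klEffectiveAction L M β U μ K klE0 0)) m X‖) (Set.finite_range _).bddAbove (q, w)

/-- The plain UV datum is nonnegative (`0 ≤ β`). -/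
theorem klTowerUVLev_nonneg {β : ℝ} (hβ : 0 ≤ β) (U μ : ℝ) (K : TrigPolyC4v) (m : ℕ) : 0 ≤ klTowerUVLev L M β U μ K m :=
  hubbardSectorKernelNorm_nonneg hβ _ _ _

end Summit.HubbardSuperconductivity.HubbardSuperconductivity.Theorems.EngineV8

end
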